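import Mathlib
import HarnessLib
import HarnessLib.Audit
import Summits.ValiantsHypothesis.ValiantsHypothesis.Theorems.LacunarySymmetroidMatrixDescartesConcavity

/-!
# ValiantsHypothesis / LacunarySymmetroid — crux `MatrixDescartes` (stmt-ValiantsHypothesis-18050, V1), LINE (A) «product_plus_one»:
# PUSH/PULL RANGES and knee counts for EVERY one-change row type

Fourteenth part of the concavity budget.  The floor `OneChangeFloorK3` concerns companies of one-change rows `g = a₀ + a₁t^a + a₂t^c`
(`0 < a < c`; up to a global sign: T1 `(+,+,+)`, T4 `(+,+,−)`, T5 `(+,−,−)`, degenerate letters allowed).  For the push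
`u = t g′/g = N/g` (`N = a·a₁t^a + c·a₂t^c`) and the row Wronskian `W = a²a₀a₁t^a + c²a₀a₂t^c + (c−a)²a₁a₂t^{a+c}` (`t·u′ = W/g²`,
✓ `…Rise`), the elementary RANGE facts that drive the dip mechanism for mixed companies (✓ `…Knee` has the T5 post-root bound `u > a`):

* `logDeriv_lt_bottom_of_pos` — `a₀ > 0`, `a₂ ≤ 0` (T4, T5), before the root (`g(t) > 0`): `u(t) < a`;
* `logDeriv_lt_top_of_pos` — `a₀ > 0`, `a₁ ≥ 0` (T1, T4), where `g(t) > 0`: `u(t) < c`;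
* `logDeriv_gt_top_of_neg` — `a₀ > 0`, `a₁ ≥ 0` (T4), past the root (`g(t) < 0`): `u(t) > c` (a switched T4 row pushes HARDER than `c`
  and, by the next item, only decreases: it never creates a dip after switching);
* `rowWronskian_nonpos_persist_T4` — `a₀, a₁ ≥ 0 ≥ a₂`: `W(t₁) ≤ 0`, `0 < t₁ ≤ t₂` ⇒ `W(t₂) ≤ 0` (ONE maximum of `u`: T4 rows rise only
  before it, inside `(0, a)` by the first item — rise budget `< a`);
* `rowWronskian_nonneg_T1` — all letters `≥ 0`: `W ≥ 0` (T1 rows are log-convex in `log t`: `u ↑` from `0` towards `c`, rise budget `< c`).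

Together with ✓ `…Rise`/`…Knee` (T5: one knee, rise `< c − a` inside `(a, c)`): EVERY one-change row's push has total rise `< c`, the
budget side of the dip mechanism for the whole floor class (NOTE rev 5 of this hand).

HONEST FRAMING: per-row algebra, def-free, no named facts, no sorry, standard axioms; closes NO stub by name; `OneChangeFloorK3`,
`MatrixDescartes` (stmt-ValiantsHypothesis-18050) OPEN; `VP ≠ VNP` is NOT proved and nothing here bears on it.

[folklore] Elementary algebra; no citation needed.
-/

set_option linter.dupNamespace false

namespace Summit.ValiantsHypothesis.ValiantsHypothesis.Theorems.LacunarySymmetroidMatrixDescartes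

namespace ZeroChange

open Polynomial

/-- Before the root of a row with `a₀ > 0`, `a₂ ≤ 0` (`0 < a < c`, `t > 0`, `g(t) > 0`): `u(t) < a`. -/
theorem logDeriv_lt_bottom_of_pos (a c : ℕ) (ha : 0 < a) (hac : a < c) {a₀ a₁ a₂ : ℝ} (h₀ : 0 < a₀) (h₂ : a₂ ≤ 0)
    {t : ℝ} (ht : 0 < t) (hg : 0 < (row a c a₀ a₁ a₂).eval t) :
    t * (derivative (row a c a₀ a₁ a₂)).eval t / (row a c a₀ a₁ a₂).eval t < (a : ℝ) := by
  have ha' : (0 : ℝ) < a := by exact_mod_cast ha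
  have hca : (0 : ℝ) ≤ (c : ℝ) - a := by
    have : (a : ℝ) < c := by exact_mod_cast hac
    linarith
  have hγ : a₂ * t ^ c ≤ 0 := mul_nonpos_iff.2 (Or.inr ⟨h₂, (pow_pos ht c).le⟩)
  rw [mul_eval_derivative_row, div_lt_iff₀ hg, eval_row]
  nlinarith [mul_nonpos_iff.2 (Or.inl ⟨hca, hγ⟩), mul_pos ha' h₀]

/-- Where a row with `a₀ > 0`, `a₁ ≥ 0` is positive (`0 < a < c`, `t > 0`): `u(t) < c`. -/
theorem logDeriv_lt_top_of_pos (a c : ℕ) (ha : 0 < a) (hac : a < c) {a₀ a₁ a₂ : ℝ} (h₀ : 0 < a₀) (h₁ : 0 ≤ a₁)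
    {t : ℝ} (ht : 0 < t) (hg : 0 < (row a c a₀ a₁ a₂).eval t) :
    t * (derivative (row a c a₀ a₁ a₂)).eval t / (row a c a₀ a₁ a₂).eval t < (c : ℝ) := by
  have hc' : (0 : ℝ) < c := by exact_mod_cast (ha.trans hac)
  have hca : (0 : ℝ) ≤ (c : ℝ) - a := by
    have : (a : ℝ) < c := by exact_mod_cast hac
    linarith
  have hβ : 0 ≤ a₁ * t ^ a := mul_nonneg h₁ (pow_pos ht a).le
  rw [mul_eval_derivative_row, div_lt_iff₀ hg, eval_row]
  nlinarith [mul_nonneg hca hβ, mul_pos hc' h₀]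

/-- Past the root of a row with `a₀ > 0`, `a₁ ≥ 0` (a switched T4 row; `0 < a < c`, `t > 0`, `g(t) < 0`): `u(t) > c`. -/
theorem logDeriv_gt_top_of_neg (a c : ℕ) (ha : 0 < a) (hac : a < c) {a₀ a₁ a₂ : ℝ} (h₀ : 0 < a₀) (h₁ : 0 ≤ a₁)
    {t : ℝ} (ht : 0 < t) (hg : (row a c a₀ a₁ a₂).eval t < 0) :
    (c : ℝ) < t * (derivative (row a c a₀ a₁ a₂)).eval t / (row a c a₀ a₁ a₂).eval t := by
  have hc' : (0 : ℝ) < c := by exact_mod_cast (ha.trans hac)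
  have hca : (0 : ℝ) ≤ (c : ℝ) - a := by
    have : (a : ℝ) < c := by exact_mod_cast hac
    linarith
  have hβ : 0 ≤ a₁ * t ^ a := mul_nonneg h₁ (pow_pos ht a).le
  rw [mul_eval_derivative_row, lt_div_iff_of_neg hg, eval_row]
  nlinarith [mul_nonneg hca hβ, mul_pos hc' h₀]

/-- **T4 rows have one maximum of the push**: for `a₀, a₁ ≥ 0 ≥ a₂` the row Wronskian, once `≤ 0`, stays `≤ 0` to the right
(`W/t^a = a²a₀a₁ − c²a₀|a₂|t^{c−a} − (c−a)²a₁|a₂|t^c` is non-increasing). -/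
theorem rowWronskian_nonpos_persist_T4 (a c : ℕ) (hac : a ≤ c) {a₀ a₁ a₂ : ℝ} (h₀ : 0 ≤ a₀) (h₁ : 0 ≤ a₁) (h₂ : a₂ ≤ 0)
    {t₁ t₂ : ℝ} (ht₁ : 0 < t₁) (h12 : t₁ ≤ t₂)
    (hW : (a : ℝ) ^ 2 * a₀ * a₁ * t₁ ^ a + (c : ℝ) ^ 2 * a₀ * a₂ * t₁ ^ c + ((c : ℝ) - a) ^ 2 * a₁ * a₂ * t₁ ^ (a + c) ≤ 0) :
    (a : ℝ) ^ 2 * a₀ * a₁ * t₂ ^ a + (c : ℝ) ^ 2 * a₀ * a₂ * t₂ ^ c + ((c : ℝ) - a) ^ 2 * a₁ * a₂ * t₂ ^ (a + c) ≤ 0 := by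
  obtain ⟨d, rfl⟩ : ∃ d, c = a + d := ⟨c - a, by omega⟩
  have ht₂ : 0 < t₂ := lt_of_lt_of_le ht₁ h12
  set A : ℝ := (a : ℝ) ^ 2 * a₀ * a₁ with hA
  set B : ℝ := ((a + d : ℕ) : ℝ) ^ 2 * a₀ * (-a₂) with hB
  set C : ℝ := (((a + d : ℕ) : ℝ) - a) ^ 2 * a₁ * (-a₂) with hC
  have hB0 : 0 ≤ B := mul_nonneg (mul_nonneg (sq_nonneg _) h₀) (neg_nonneg.2 h₂)
  have hC0 : 0 ≤ C := mul_nonneg (mul_nonneg (sq_nonneg _) h₁) (neg_nonneg.2 h₂)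
  have e : ∀ t : ℝ, (a : ℝ) ^ 2 * a₀ * a₁ * t ^ a + ((a + d : ℕ) : ℝ) ^ 2 * a₀ * a₂ * t ^ (a + d) +
      (((a + d : ℕ) : ℝ) - a) ^ 2 * a₁ * a₂ * t ^ (a + (a + d)) = t ^ a * (A - B * t ^ d - C * (t ^ a * t ^ d)) := by
    intro t; simp only [hA, hB, hC, pow_add]; ring
  rw [e] at hW ⊢
  have hp1a : 0 < t₁ ^ a := pow_pos ht₁ a
  have hp2a : 0 < t₂ ^ a := pow_pos ht₂ a
  have hda : t₁ ^ a ≤ t₂ ^ a := pow_le_pow_left₀ ht₁.le h12 a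
  have hdd : t₁ ^ d ≤ t₂ ^ d := pow_le_pow_left₀ ht₁.le h12 d
  have hW' : A - B * t₁ ^ d - C * (t₁ ^ a * t₁ ^ d) ≤ 0 := by
    by_contra hpos
    have : 0 < t₁ ^ a * (A - B * t₁ ^ d - C * (t₁ ^ a * t₁ ^ d)) := mul_pos hp1a (not_le.1 hpos)
    linarith
  have hmono : A - B * t₂ ^ d - C * (t₂ ^ a * t₂ ^ d) ≤ A - B * t₁ ^ d - C * (t₁ ^ a * t₁ ^ d) := by
    have h1 : t₁ ^ a * t₁ ^ d ≤ t₂ ^ a * t₂ ^ d := mul_le_mul hda hdd (pow_pos ht₁ d).le hp2a.le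
    nlinarith [mul_le_mul_of_nonneg_left hdd hB0, mul_le_mul_of_nonneg_left h1 hC0]
  exact mul_nonpos_iff.2 (Or.inl ⟨hp2a.le, hmono.trans hW'⟩)

/-- **T1 rows are log-convex**: with all letters `≥ 0` the row Wronskian is `≥ 0` everywhere on `t ≥ 0`. -/
theorem rowWronskian_nonneg_T1 (a c : ℕ) {a₀ a₁ a₂ : ℝ} (h₀ : 0 ≤ a₀) (h₁ : 0 ≤ a₁) (h₂ : 0 ≤ a₂) {t : ℝ} (ht : 0 ≤ t) :
    0 ≤ (a : ℝ) ^ 2 * a₀ * a₁ * t ^ a + (c : ℝ) ^ 2 * a₀ * a₂ * t ^ c + ((c : ℝ) - a) ^ 2 * a₁ * a₂ * t ^ (a + c) := by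
  have h1 : 0 ≤ (a : ℝ) ^ 2 * a₀ * a₁ * t ^ a := by positivity
  have h2 : 0 ≤ (c : ℝ) ^ 2 * a₀ * a₂ * t ^ c := by positivity
  have h3 : 0 ≤ ((c : ℝ) - a) ^ 2 * a₁ * a₂ * t ^ (a + c) := by positivity
  linarith

end ZeroChange

end Summit.ValiantsHypothesis.ValiantsHypothesis.Theorems.LacunarySymmetroidMatrixDescartes
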